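import Mathlib
import HarnessLib
import Summits.HubbardSuperconductivity.HubbardSuperconductivity.Theorems.KLProgrammeKLRegimeEngineTowerRemeasureNarrowWideSplitWt
import Summits.HubbardSuperconductivity.HubbardSuperconductivity.Theorems.KLProgrammeKLRegimeEngineTowerRemeasureSplitWtAll

/-!
# Route `KLProgramme` — crux K3 ENGINE (stmt-HubbardSuperconductivity-20437 `KLRegimeEngineV17F2`), stub (b) v2, THE LEVELS PACKAGE (ℓ), (I2) jump half:
# THE NARROW / WIDE SPLIT OF THE UMKLAPP-ACTIVE CLASS, WEIGHTED TRACK AT THE FLOW FRAME, NO DEPTH WINDOW — the `_flow_all` re-key (X3) of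
# k3c2-p3's `klWtPinnedSumAt_jump_le_narrowWideSplit_klEng_flow_deep` (located item «(I2)-WT-WINDOW»; cell gate-hubbard-kl, seat p4 g17, owner's concurrence)

`…EngineTowerRemeasureNarrowWideSplitWt` (k3c2-p3 g11) is keyed by p3's deep window `4ⁿ·U ≤ 4^{2(k+1)+dd}`.  This is the SAME theorem and proof with the split base
row `klWtPinnedSumAt_jump_le_split_klEng_flow_all (m) (R) (c″)` (…EngineTowerRemeasureSplitWtAll, reading the window-free general-jump overlap
`overlapWt_jump_sums_klEng_flow_all`) in place of `…_flow_deep dd m`: the window binder is GONE, the `FrameOK` binder is derived from the history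
(`frameOK_klFlowFrameU_of_histP_le`), and W5's extra binders (`c″U ≤ 1`, `IsKLRegime U cc (−n)`, the REGISTERED (K5′) clauses) are added; `R` and `c″` are parameters
(the overlap constant depends on them through `c″ + Gfr₁ + Gfr₂ + Gfr₃ + 1`).

**`klWtPinnedSumAt_jump_le_narrowWideSplit_klEng_flow_all (m) (hm : 3 ≤ m) (R) (c″)`** — the pinned leg `q` of the weighted track is the distinguished leg of the
narrow cone, the class is `B = ON(G₀ ≠ 0) ∩ NARROW_q(⌊(Θ+5w_k)/w_k⌋)`; OFF `B` the `(m+1)−3` count (`PerturbedFermiCurve.card_relCount_prescribed_offOrWide_klAniso_le_window`),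
ON `B` the one-determined-leg count against (narrow multiplicity `PerturbedFermiCurve.card_onNarrow_pinned_le_window`) × (a bound `N_f` on the SINGLE-TUPLE weighted
pinned sums): the same right-hand side as the `_flow_deep` row, for every `k₀ ≤ k`, `k + 1 ≤ J′ ≤ n`, rate `j ≥ J′`.
Everything is proved; no definitions; nothing about the model is asserted; nothing asserts superconductivity.
References: BGM 2006 §2.8 (2.82)–(2.84), (2.88)–(2.90), §3 (3.2)–(3.8), App. A3 Lemma A3.1; BGM 2003 §3.1 Lemma 3.1, §7.4
[cite: BenfattoGiulianiMastropietro2006; BenfattoGiulianiMastropietro2003].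
-/

noncomputable section

namespace Summit.HubbardSuperconductivity.HubbardSuperconductivity.Theorems.EngineV8

set_option linter.dupNamespace false -- summit = problem name (single-conjunct summit), D-0017

open Classical
open Real Finset Literature.MathematicalPhysics.QuantumLattice Literature.Probability.LatticeModels GrassmannAlgebra
open Literature.MathematicalPhysics.QuantumLattice.FermiRG
open Summit.HubbardSuperconductivity.HubbardSuperconductivity.Theorems.KLRegimeSplit
open Summit.HubbardSuperconductivity.HubbardSuperconductivity.Theorems.KLProgrammeLegKernels
open Summit.HubbardSuperconductivity.HubbardSuperconductivity.Theorems.DispersionFlow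
open Summit.HubbardSuperconductivity.HubbardSuperconductivity.Theorems.KLRegimeWick
open Summit.HubbardSuperconductivity.HubbardSuperconductivity.Theorems.TorusFourierL2
open Summit.HubbardSuperconductivity.HubbardSuperconductivity.Theorems.PerturbedFermiCurve

variable {L M : ℕ} [NeZero L] [NeZero M]

/-! ## The weighted jump at the flow frame, narrow / wide split, all counts discharged, no window -/

/-- **THE WEIGHTED JUMP AT THE FLOW FRAME (NO depth window), NARROW / WIDE SPLIT, ALL COUNTS DISCHARGED** (`m + 1 ≥ 4` legs; every rate `j ≥ J′`; the pinned
leg `q` of the weighted track is the distinguished leg of the narrow cone).  The on-class input is a bound `N_f` on the SINGLE-TUPLE weighted pinned sums (all coarse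
labels fixed; E1's `b₃`-type datum), multiplied by the narrow multiplicity.
[cite: BenfattoGiulianiMastropietro2006, §2.8 (2.82)-(2.84), (2.88)-(2.90), App. A3] -/
theorem klWtPinnedSumAt_jump_le_narrowWideSplit_klEng_flow_all (m : ℕ) (hm : 3 ≤ m) (R : RenConsts) (c'' : ℝ) (hc'' : 0 ≤ c'') :
    ∃ Cm : ℝ, 0 < Cm ∧ ∃ C : ℝ, 0 < C ∧ ∃ D₁ : ℝ, 0 < D₁ ∧ ∃ Cw : ℝ, 0 < Cw ∧
      ∃ c₂ cb K₁ K₂ c₀ c₂' : ℝ, 0 ≤ c₂ ∧ 0 < cb ∧ 2 + c₂ ≤ K₁ ∧ 0 < K₂ ∧ 0 < c₀ ∧ 0 < c₂' ∧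
      ∃ D₂ : ℝ, 0 < D₂ ∧ ∃ k₀ : ℕ,
      (R.WF2 → ∃ c₃ : ℝ, 0 < c₃ ∧ ∃ U₀ : ℝ, 0 < U₀ ∧ ∃ Λ : ℝ, 0 ≤ Λ ∧ ∃ r₀ : ℝ, 0 < r₀ ∧ ∃ v₀ : ℝ, 0 < v₀ ∧
      ∀ (G : GeoConsts) (P : SplitConsts) (Q : EngConsts) (cc : ℝ), 0 < cc → cc ≤ klEngC₃6 P R → cc ≤ c₃ →
      ∀ μ ∈ klWindowC, ∀ U : ℝ, 0 < U → U ≤ min (klEngU₀3 P R cc) (1 / (R.Gfr 3 + 1)) → U ≤ U₀ → c'' * U ≤ 1 →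
      ∀ β : ℝ, klBetaMin ≤ β → β ≤ Real.exp (cc / U ^ 2) →
      ∀ (L M : ℕ) [NeZero L] [NeZero M], klEngL₃ β U ≤ L → klEngM₃ β U L ≤ M →
      ∀ n : ℕ, 1 ≤ n → n ≤ nScales β + 1 → IsKLRegime U cc (-(n : ℤ)) → HistP klPredsV17F2 L M G P Q R β U μ 0 n →
        (∀ m', 1 ≤ m' → m' < n → FlowPieceOscAt L M c'' β U μ m') →
        ∀ k J' : ℕ, k₀ ≤ k → k + 1 ≤ J' → J' ≤ n →
      ∀ (Θ LΨ Bfib : ℝ), LΨ = (m + 1 : ℕ) + c₂ * (π / 2 + 5 * sectorWidth k) / (K₁ * Θ) → (2 : ℝ) ^ (-(J' : ℤ)) ≤ Θ →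
        cb * (2 : ℝ) ^ (-(J' : ℤ)) ≤ Θ → K₂ * LΨ * (cb * (2 : ℝ) ^ (-(J' : ℤ))) ≤ c₂' * Θ →
        max ((2 * ((2 * c₀ * K₂ * cb / π + 1) * LΨ)) ^ 2) (4 * cb ^ 2 * K₂ ^ 2 / 1 ^ 2 * LΨ ^ 2) ≤ Bfib →
      ((m : ℝ) + 1) * (Cw + C) * sectorWidth k < 2 * π →
      (((m : ℝ) + 1) * C + m * Λ * (⌊(Θ + 5 * sectorWidth k) / sectorWidth k⌋₊ : ℕ)) * sectorWidth k < v₀ →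
      ((m : ℝ) + 1) * C * sectorWidth k < π →
        ∀ T : HubbardGrassmann L M,
          (∀ (m' : ℕ) (X : Fin m' → HubbardFieldIdx L M), ∑ i, signedMomentum L (X i).2 (X i).1.1.2 ≠ 0 → kernel ℂ T m' X = 0) →
        ∀ j : ℕ, J' ≤ j → ∀ (q : Fin (m + 1)) (w : SpaceTimeIdx L M × SectorLeg (sectorCount J')) (N Nf : ℝ), 0 ≤ N → 0 ≤ Nf →
          (∀ w' : SpaceTimeIdx L M × SectorLeg (sectorCount k),
            klWtPinnedSumAt L M β μ (klFlowFrameU L M β U μ n) k j (m + 1) T q w' ≤ N) →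
          (∀ (σ' : Fin (m + 1) → SectorLeg (sectorCount k)) (y' : SpaceTimeIdx L M),
            imagTimeWeight β M ^ m *
              ∑ x' ∈ univ.filter (fun x' : Fin (m + 1) → SpaceTimeIdx L M => x' q = y'),
                klScaleWt L M β j ((univ.image x').image (fun x : SpaceTimeIdx L M => (((((2 * (x.1 : ℕ) : ℕ)) : ZMod (2 * (2 * M)))), x.2))) *
                  ‖sectorisedKernel L M β (klAnisoFamily L M β μ (klFlowFrameU L M β U μ n) klE0 k) T (m + 1) σ' x'‖ ≤ Nf) →
          klWtPinnedSumAt L M β μ (klFlowFrameU L M β U μ n) J' j (m + 1) T q w ≤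
            Cm * ((27 : ℝ) * (D₁ ^ (m + 1) + (5 : ℝ) ^ (m + 1) * ((m + 1 : ℕ) ^ 2 * (Bfib * 3 ^ (m - 2)))) * ((2 : ℝ) ^ (J' - k)) ^ (m - 2) * N +
              D₂ * 27 ^ (m + 1) * ((2 : ℝ) ^ (J' - k)) ^ (m - 1) *
                ((2 * ((m : ℝ) + 1) + 1) ^ 2 * (2 * (8 * π * (((m : ℝ) + 1) * C + m * Λ * (⌊(Θ + 5 * sectorWidth k) / sectorWidth k⌋₊ : ℕ)) / r₀ + 2) *
                  (8 * (2 * ((⌊(Θ + 5 * sectorWidth k) / sectorWidth k⌋₊ : ℕ) : ℝ) + 1)) ^ m)) * Nf)) := by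
  obtain ⟨Cm, hCm, hsplit⟩ := klWtPinnedSumAt_jump_le_split_klEng_flow_all m R c'' hc''
  obtain ⟨C, hC, D₁, hD₁, Cw, hCw, c₂, cb, K₁, K₂, c₀, c₂', h1, h2, h3, h4, h5, h6, k₀, hoffR⟩ :=
    card_relCount_prescribed_offOrWide_klAniso_le_window
  obtain ⟨D₂, hD₂, honR⟩ := card_relCount_prescribed_lastLeg_klAniso_le_window m
  refine ⟨Cm, hCm, C, hC, D₁, hD₁, Cw, hCw, c₂, cb, K₁, K₂, c₀, c₂', h1, h2, h3, h4, h5, h6, D₂, hD₂, k₀, fun hR2 => ?_⟩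
  have hRj : ∀ j, 0 ≤ R.Gfr j := gfr_nonneg_of_wf2 hR2
  obtain ⟨c₃, hc₃, U₀, hU₀, hoff'⟩ := hoffR R hRj
  obtain ⟨c₃', hc₃', U₀', hU₀', hon'⟩ := honR R hRj
  obtain ⟨c₃'', hc₃'', U₀'', hU₀'', Λ, hΛ, r₀, hr₀, v₀, hv₀, hmult⟩ := card_onNarrow_pinned_le_window R hRj
  refine ⟨min (min c₃ c₃') c₃'', lt_min (lt_min hc₃ hc₃') hc₃'', min (min U₀ U₀') U₀'', lt_min (lt_min hU₀ hU₀') hU₀'', Λ, hΛ, r₀, hr₀, v₀, hv₀, ?_⟩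
  intro G P Q cc hcc hcc6 hccm μ hμ U hU hUle hUm hcU β hβmin hβc L M _ _ hL3 hM3 n hn1 hnN hkl hhist hosc k J' hk₀ hJ hJn Θ LΨ Bfib hLΨ hΘt hΘδ hΘη hBfib
    hsmall hsmallv hπC T hT j hjJ q w N Nf hN0 hNf0 hN hNf
  have hβ : 0 < β := KLRegimeSplit.pos_of_klBetaMin_le hβmin
  have hfr : FrameOK R U (nScales β) μ (klFlowFrameU L M β U μ n) := frameOK_klFlowFrameU_of_histP_le hR2 hn1 le_rfl hnN hhist
  have hε0 : 0 ≤ imagTimeWeight β M := imagTimeWeight_nonneg hβ.le M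
  have hkJ : k ≤ J' := by omega
  have hc1 : cc ≤ c₃ := hccm.trans ((min_le_left _ _).trans (min_le_left _ _))
  have hc2 : cc ≤ c₃' := hccm.trans ((min_le_left _ _).trans (min_le_right _ _))
  have hc3 : cc ≤ c₃'' := hccm.trans (min_le_right _ _)
  have hU1 : U ≤ U₀ := hUm.trans ((min_le_left _ _).trans (min_le_left _ _))
  have hU2 : U ≤ U₀' := hUm.trans ((min_le_left _ _).trans (min_le_right _ _))
  have hU3 : U ≤ U₀'' := hUm.trans (min_le_right _ _)
  have hBfib0 : 0 ≤ Bfib := le_trans (le_trans (sq_nonneg _) (le_max_left _ _)) hBfib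
  set K : TrigPolyC4v := klFlowFrameU L M β U μ n with hK
  set C' : ℕ := ⌊(Θ + 5 * sectorWidth k) / sectorWidth k⌋₊ with hC'
  set B : Finset (Fin (m + 1) → SectorLeg (sectorCount k)) :=
    univ.filter fun σ' : Fin (m + 1) → SectorLeg (sectorCount k) =>
      (∃ G₀ : Fin 2 → ℤ, G₀ ≠ 0 ∧ ∀ j : Fin 2,
          |∑ i, (if (σ' i).2 = 0 then klFermiPoint μ K (sectorCenter k (σ' i).1.1) j
            else -klFermiPoint μ K (sectorCenter k (σ' i).1.1) j) - 2 * π * (G₀ j : ℝ)| ≤ ((m : ℝ) + 1) * C * sectorWidth k) ∧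
      (∃ b : Fin (sectorCount k), ∀ i, i ≠ q → ∃ Dz : ℤ, |Dz| ≤ (C' : ℕ) ∧ ((2 : ℤ) ^ k) ∣
        ((((if (σ' i).2 = 0 then ((σ' i).1.1 : ℕ) else
            if ((σ' i).1.1 : ℕ) < 2 ^ k then ((σ' i).1.1 : ℕ) + 2 ^ k else ((σ' i).1.1 : ℕ) - 2 ^ k : ℕ) : ℤ)) - b - Dz)) with hB
  set Mult : ℝ := (2 * ((m : ℝ) + 1) + 1) ^ 2 * (2 * (8 * π * (((m : ℝ) + 1) * C + m * Λ * (C' : ℕ)) / r₀ + 2) * (8 * (2 * ((C' : ℕ) : ℝ) + 1)) ^ m)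
    with hMult
  have hMult0 : 0 ≤ Mult := by positivity
  -- the on-class pinned weighted sums: multiplicity × single-tuple sums
  have hNB : ∀ (ℓ' : SectorLeg (sectorCount k)) (y' : SpaceTimeIdx L M),
      imagTimeWeight β M ^ m * ∑ σ' ∈ B.filter (fun σ' : Fin (m + 1) → SectorLeg (sectorCount k) => σ' q = ℓ'),
        ∑ x' ∈ univ.filter (fun x' : Fin (m + 1) → SpaceTimeIdx L M => x' q = y'),
          klScaleWt L M β j ((univ.image x').image (fun x : SpaceTimeIdx L M => (((((2 * (x.1 : ℕ) : ℕ)) : ZMod (2 * (2 * M)))), x.2))) *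
            ‖sectorisedKernel L M β (klAnisoFamily L M β μ K klE0 k) T (m + 1) σ' x'‖ ≤ Mult * Nf := by
    intro ℓ' y'
    refine (mul_sum_le_card_mul _ _ fun σ' _ => hNf σ' y').trans (mul_le_mul_of_nonneg_right ?_ hNf0)
    have hcnt := hmult cc hcc hc3 U hU hU3 β hβmin hβc μ hμ μ K hfr k m q ℓ' C hC.le C' hsmallv hπC
    refine le_trans (Nat.cast_le.2 (card_le_card fun σ' hσ' => ?_)) hcnt
    simp only [hB, mem_filter, mem_univ, true_and] at hσ' ⊢
    obtain ⟨⟨⟨G₀, _, hG₀⟩, hnar⟩, hpℓ⟩ := hσ'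
    exact ⟨hpℓ, ⟨G₀, hG₀⟩, hnar⟩
  have hA₁ : (0 : ℝ) ≤ (27 : ℝ) * (D₁ ^ (m + 1) + (5 : ℝ) ^ (m + 1) * ((m + 1 : ℕ) ^ 2 * (Bfib * 3 ^ (m - 2)))) * ((2 : ℝ) ^ (J' - k)) ^ (m - 2) := by
    positivity
  have hA₂ : (0 : ℝ) ≤ D₂ * 27 ^ (m + 1) * ((2 : ℝ) ^ (J' - k)) ^ (m - 1) := by positivity
  have hMN : 0 ≤ Mult * Nf := mul_nonneg hMult0 hNf0
  have h := hsplit G P Q cc hR2 hcc hcc6 μ hμ U hU hUle hcU β hβmin hβc L M hL3 hM3 n hn1 hnN hkl hhist hosc k J' hJ hJn T hT j hjJ B q w _ _ N (Mult * Nf)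
    hA₁ hA₂ hN0 hMN (fun ℓ'' σ' hσ' => ?_) (fun ℓ'' σ' _ => ?_) hN hNB
  · calc klWtPinnedSumAt L M β μ (klFlowFrameU L M β U μ n) J' j (m + 1) T q w
        ≤ Cm * ((27 : ℝ) * (D₁ ^ (m + 1) + (5 : ℝ) ^ (m + 1) * ((m + 1 : ℕ) ^ 2 * (Bfib * 3 ^ (m - 2)))) * ((2 : ℝ) ^ (J' - k)) ^ (m - 2) * N +
            D₂ * 27 ^ (m + 1) * ((2 : ℝ) ^ (J' - k)) ^ (m - 1) * (Mult * Nf)) := h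
      _ = _ := by rw [hMult]; ring
  · -- off the class: off the umklapp class, or on it for some `G₀ ≠ 0` and not narrow about `q` ⇒ wide
    have hnot : ¬ ((∃ G₀ : Fin 2 → ℤ, G₀ ≠ 0 ∧ ∀ j : Fin 2,
          |∑ i, (if (σ' i).2 = 0 then klFermiPoint μ K (sectorCenter k (σ' i).1.1) j
            else -klFermiPoint μ K (sectorCenter k (σ' i).1.1) j) - 2 * π * (G₀ j : ℝ)| ≤ ((m : ℝ) + 1) * C * sectorWidth k) ∧
        (∃ b : Fin (sectorCount k), ∀ i, i ≠ q → ∃ Dz : ℤ, |Dz| ≤ (⌊(Θ + 5 * sectorWidth k) / sectorWidth k⌋₊ : ℕ) ∧ ((2 : ℤ) ^ k) ∣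
          ((((if (σ' i).2 = 0 then ((σ' i).1.1 : ℕ) else
              if ((σ' i).1.1 : ℕ) < 2 ^ k then ((σ' i).1.1 : ℕ) + 2 ^ k else ((σ' i).1.1 : ℕ) - 2 ^ k : ℕ) : ℤ)) - b - Dz))) := by
      intro hh
      exact hσ' (by simp only [hB, mem_filter, mem_univ, true_and]; exact hh)
    have hcnt := hoff' cc hcc hc1 U hU hU1 β hβmin hβc μ hμ μ K hfr L M m k J' hk₀ hkJ hm hsmall _ subset_rfl
      ({q} : Finset (Fin (m + 1))) (fun _ => ℓ'') q (mem_singleton_self _) σ' Θ LΨ Bfib hLΨ hΘt hΘδ hΘη hBfib hnot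
    have h1 := offOrWide_count_arith hD₁.le hBfib0 (J' - k) m 0 1 hm (by omega)
    simp only [pow_one, zero_add] at h1
    exact (mul_le_mul_of_nonneg_left hcnt (by norm_num)).trans h1
  · -- on the class: the one-determined-leg count
    have hcnt := hon' cc hcc hc2 U hU hU2 β hβmin hβc μ hμ μ K hfr L M k J' hkJ _ subset_rfl
      ({q} : Finset (Fin (m + 1))) (fun _ => ℓ'') σ'
    have h1 := legSet_count_arith hD₂.le (J' - k) m 1 1 le_rfl (by omega)
    rw [card_singleton] at hcnt
    rw [pow_one] at h1
    exact (mul_le_mul_of_nonneg_left hcnt (by norm_num)).trans h1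

end Summit.HubbardSuperconductivity.HubbardSuperconductivity.Theorems.EngineV8

end
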